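import Summits.HodgeConjecture.HodgeConjecture.Theorems.HeckePrymWeilProductDescent
import Literature.AlgebraicGeometry.HodgeTheory.ComplexConjugationHolds
import Literature.AlgebraicGeometry.HodgeTheory.LefschetzOneOneHolds
import Literature.AlgebraicGeometry.HodgeTheory.HodgeIndexPrimitiveAlgebraicHolds
import Literature.NumberTheory.Transcendental.DeRhamTheoremMultiplicative
import HarnessLib

/-!
# `ProductDescent` (item stmt-HodgeConjecture-14498, route HeckePrymWeil) — unconditional

The support item `ProductDescent` of route `HeckePrymWeil` was proved CONDITIONALLY in
`Theorems/HeckePrymWeilProductDescent` (`productDescent_of`, prover seats 14498-0 and 14498-1, 2026-08-16) on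
four named facts of the tree; all four are now theorems:

* `nonempty_hodgeModel` — `HodgeTheory.nonempty_hodgeModel_holds` (`HodgeTheory/ComplexConjugationHolds`);
* `exists_deRhamIsoFamily 𝓘(ℝ, E)` — `Transcendental.exists_deRhamIsoFamily_holds`
  (`NumberTheory/Transcendental/DeRhamTheoremMultiplicative`);
* `lefschetzOneOne_rational` — `HodgeTheory.lefschetzOneOne_rational_holds` (`HodgeTheory/LefschetzOneOneHolds`);
* `hodgeIndex_surface X` — `HodgeTheory.hodgeIndex_surface_holds` (`HodgeTheory/HodgeIndexPrimitiveAlgebraicHolds`).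

This leaf only composes them: `productDescent_proof : Theses.HeckePrymWeil.ProductDescent`.
-/

-- every declaration of this problem lives in `Summit.HodgeConjecture.HodgeConjecture.…` (summit = sub-problem)
set_option linter.dupNamespace false

namespace Summit.HodgeConjecture.HodgeConjecture.Theorems

open Literature.AlgebraicGeometry.HodgeTheory Literature.NumberTheory.Transcendental

/-- **`ProductDescent` holds** (route `HeckePrymWeil`, item stmt-HodgeConjecture-14498): Schoen's product
step in its filed form — if for every Weil pair `(A, φ)` of dimension `2n` a balanced Weil surface partner
`(B, ψ, b)` exists for which every rational `(n+1,n+1)` Weil class of `(A × B, φ × ψ)` is algebraic, then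
every rational `(n,n)` Weil class of `(A, φ)` is algebraic. By `productDescent_of` with its four premises
discharged: Hodge models exist, de Rham's theorem (multiplicative form), Lefschetz `(1,1)`, Hodge index
for surfaces. -/
theorem productDescent_proof : Theses.HeckePrymWeil.ProductDescent :=
  productDescent_of (fun _ _ ↦ nonempty_hodgeModel_holds) (fun E _ _ _ ↦ exists_deRhamIsoFamily_holds E)
    lefschetzOneOne_rational_holds (fun _ ↦ hodgeIndex_surface_holds)

end Summit.HodgeConjecture.HodgeConjecture.Theorems
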